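import Literature.AlgebraicGeometry.GroupSchemes.ReductionKernelKilledByNSquare
import Literature.AlgebraicGeometry.Morphisms.FpqcDescentOfMorphisms
import HarnessLib

/-!
# Descent of the `N`-th power of a LOCAL lift through a square-zero thickening along an fpqc cover
# ([Katz1981SerreTate] §1.1 Lemmas 1.1.1–1.1.3, «any two lifts agree after multiplication by `N`»; [GortzWedhorn2020] Thm. 14.72)

Topic `Literature/AlgebraicGeometry/GroupSchemes`, namespace `Literature.AlgebraicGeometry.GroupSchemes.PowerLiftDescent`.
THEOREMS ONLY (no definition, no named fact, no instance, no notation, no `sorry`).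

The «(s2) assembly» of the cell's Serre–Tate line (P6b wave A, seat B6), stated GENERICALLY: `A` a local ring, `J ⊆ A` an ideal
with `J² = 0` and `N · J = 0`; `G` a COMMUTATIVE group object of `Over (Spec A)`; `T` any `Spec A`-scheme with its reduction square
`(ρ : T₀ → T, b : T₀ → Spec (A⧸J))` (cartesian over the thickening `Spec (A⧸J) ↪ Spec A`); `u₀ : T₀ → G` a morphism of schemes
(the point to be lifted, known on the thickening only); `c : V → T` a flat, surjective, quasi-compact cover (fpqc) carrying ONE lift
`F : V → G` of `u₀` (i.e. `F ∣_{V ×_T T₀} = u₀ ∘ pr₂`).  Then: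

* `pow_comp_eq_pow_comp_of_localLift` — the two pull-backs of `F ^ N` to the kernel pair `V ×_T V` AGREE: their quotient
  `(pr₁ ≫ F) / (pr₂ ≫ F)` is the unit on the thickening `(V ×_T V)₀`, hence killed by `N` (Drinfeld rigidity, ★
  `ReductionKernel.pow_eq_one_of_isPullback`), and `G` is commutative (`(a / b) ^ N = a ^ N / b ^ N`);
* `existsUnique_desc_pow_of_localLift` — hence `F ^ N` DESCENDS uniquely along `c` (fpqc descent of morphisms, ★
  `Morphisms.SchemeOver.existsUnique_desc_of_pullback_comp_eq`): `∃! δ : T ⟶ G, c ≫ δ = F ^ N`.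

No affineness of `T` or `V`, no finiteness of `c`, and no second lift on overlaps is needed.  In the Serre–Tate application
(`N = p`, `G = B[p^m]`, `T = Y[p²]`, `u₀ = ε₂⁻¹`, the cover and the lift supplied by the unit-component spine) `δ` is the homomorphism
«`p` × any local lift» of [Katz1981SerreTate] §1.1; Katz phrases the same computation with a global lift (Lemma 1.1.3 (3)), the
fpqc-local form is [GortzWedhorn2020] Thm. 14.72 applied to it.

Cell `pub/hodgecm-mathlib`, P6b wave A seat B6 (LA3-p03 (g8)); generic, count-neutral capital `--supports stmt-HodgeConjecture-24832`.
HC_CM is proved only modulo the printed citations until rung 0 closes.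

## References
* [Katz1981SerreTate] N. M. Katz, *Serre–Tate local moduli*, LNM 868 (1981), §1.1 Lemmas 1.1.1–1.1.3 (pp. 138–141).
* [GortzWedhorn2020] U. Görtz, T. Wedhorn, *Algebraic Geometry I*, 2nd ed. (2020), Thm. 14.72 (fpqc descent of morphisms).
* [StacksProject] The Stacks project, Tag 023Q.
-/

noncomputable section

universe u

open CategoryTheory CategoryTheory.Limits AlgebraicGeometry MonoidalCategory CartesianMonoidalCategory
open scoped MonObj

namespace Literature.AlgebraicGeometry.GroupSchemes.PowerLiftDescent

variable {A : Type u} [CommRing A] [IsLocalRing A] {J : Ideal A}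
  {G : Over (Spec (CommRingCat.of A))} [GrpObj G] [IsCommMonObj G]

/-- **Two local lifts have the same `N`-th power wherever they are both defined** ([Katz1981SerreTate] §1.1, the computation
behind Lemma 1.1.3 (3), fpqc-locally): `A` local, `J² = 0`, `N · J = 0`, `G` a commutative group object over `Spec A`, `(ρ, b)` the
(cartesian) reduction square of `T`, `u₀ : T₀ → G`; two covers `cᵢ : Vᵢ → T` with lifts `Fᵢ : Vᵢ → G` of `u₀`, and any `W` mapping
to both compatibly over `T` (`a₁ ≫ c₁ = a₂ ≫ c₂`).  Then `(a₁ ≫ F₁) ^ N = (a₂ ≫ F₂) ^ N`: the quotient `(a₁ ≫ F₁) / (a₂ ≫ F₂)`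
restricts to the unit on the thickening `W ×_T T₀` (both factors restrict to `(W ×_T T₀ → T₀) ≫ u₀`), so Drinfeld rigidity (★
`ReductionKernel.pow_eq_one_of_isPullback`, square pasted from `hρ`) kills it by `N`, and commutativity turns
`((a₁ ≫ F₁) / (a₂ ≫ F₂)) ^ N = 1` into the claim. [cite: Katz1981SerreTate, §1.1 Lemmas 1.1.1–1.1.3] [cite: GortzWedhorn2020, Def. 14.69] -/
theorem pow_comp_eq_pow_comp_of_localLifts (hJ : J * J = ⊥) {N : ℕ} (hN : ∀ a ∈ J, (N : A) * a = 0)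
    {T : Over (Spec (CommRingCat.of A))} {T₀ : Scheme.{u}} (ρ : T₀ ⟶ T.left) (b : T₀ ⟶ Spec (.of (A ⧸ J)))
    (hρ : IsPullback ρ b T.hom (Spec.map (CommRingCat.ofHom (Ideal.Quotient.mk J))))
    (u₀ : T₀ ⟶ G.left) {V₁ V₂ W : Over (Spec (CommRingCat.of A))} (c₁ : V₁ ⟶ T) (c₂ : V₂ ⟶ T)
    (F₁ : V₁ ⟶ G) (F₂ : V₂ ⟶ G) (hF₁ : pullback.fst c₁.left ρ ≫ F₁.left = pullback.snd c₁.left ρ ≫ u₀)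
    (hF₂ : pullback.fst c₂.left ρ ≫ F₂.left = pullback.snd c₂.left ρ ≫ u₀)
    (a₁ : W ⟶ V₁) (a₂ : W ⟶ V₂) (ha : a₁ ≫ c₁ = a₂ ≫ c₂) :
    (a₁ ≫ F₁) ^ N = (a₂ ≫ F₂) ^ N := by
  -- the structure map of `W` through `T`, and the reduction square of `W` (`W₀ := W ×_T T₀`) pasted from `hρ`
  let g : W.left ⟶ T.left := a₁.left ≫ c₁.left
  have hg₂ : a₂.left ≫ c₂.left = g := by
    change a₂.left ≫ c₂.left = a₁.left ≫ c₁.left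
    rw [← Over.comp_left, ← Over.comp_left, ha]
  have hWhom : W.hom = g ≫ T.hom := by
    change W.hom = (a₁.left ≫ c₁.left) ≫ T.hom
    rw [Category.assoc, Over.w c₁, Over.w a₁]
  have hW : IsPullback (pullback.fst g ρ) (pullback.snd g ρ ≫ b) W.hom
      (Spec.map (CommRingCat.ofHom (Ideal.Quotient.mk J))) := by
    rw [hWhom]
    exact (IsPullback.of_hasPullback g ρ).paste_vert hρ
  -- both `aᵢ ≫ Fᵢ` restrict on `W₀` to `(W₀ → T₀) ≫ u₀`
  have key : ∀ {V : Over (Spec (CommRingCat.of A))} (cV : V ⟶ T) (FV : V ⟶ G),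
      pullback.fst cV.left ρ ≫ FV.left = pullback.snd cV.left ρ ≫ u₀ → ∀ π : W.left ⟶ V.left, π ≫ cV.left = g →
      pullback.fst g ρ ≫ π ≫ FV.left = pullback.snd g ρ ≫ u₀ := by
    intro V cV FV hFV π hπ
    have hl : (pullback.fst g ρ ≫ π) ≫ cV.left = pullback.snd g ρ ≫ ρ := by
      rw [Category.assoc, hπ]
      exact pullback.condition
    rw [← Category.assoc, ← pullback.lift_fst (pullback.fst g ρ ≫ π) (pullback.snd g ρ) hl, Category.assoc, hFV,
      ← Category.assoc, pullback.lift_snd]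
  have h₁ : pullback.fst g ρ ≫ a₁.left ≫ F₁.left = pullback.snd g ρ ≫ u₀ := key c₁ F₁ hF₁ a₁.left rfl
  have h₂ : pullback.fst g ρ ≫ a₂.left ≫ F₂.left = pullback.snd g ρ ≫ u₀ := key c₂ F₂ hF₂ a₂.left hg₂
  -- hence the quotient is the unit on `W₀` …
  let ρW : Over.mk (pullback.fst g ρ ≫ W.hom) ⟶ W := Over.homMk (pullback.fst g ρ) rfl
  have hq : pullback.fst g ρ ≫ ((a₁ ≫ F₁) / (a₂ ≫ F₂)).left = pullback.fst g ρ ≫ (1 : W ⟶ G).left := by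
    have e : ρW ≫ (a₁ ≫ F₁) = ρW ≫ (a₂ ≫ F₂) :=
      Over.OverMorphism.ext (by
        change pullback.fst g ρ ≫ a₁.left ≫ F₁.left = pullback.fst g ρ ≫ a₂.left ≫ F₂.left
        rw [h₁, h₂])
    have e' : ρW ≫ ((a₁ ≫ F₁) / (a₂ ≫ F₂)) = ρW ≫ (1 : W ⟶ G) := by
      rw [GrpObj.comp_div, e, div_self', MonObj.comp_one]
    exact congrArg Over.Hom.left e'
  -- … so Drinfeld rigidity kills it by `N`, and commutativity gives the agreement of the `N`-th powers
  have hqN : ((a₁ ≫ F₁) / (a₂ ≫ F₂)) ^ N = 1 :=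
    ReductionKernel.pow_eq_one_of_isPullback hJ hN (pullback.fst g ρ) (pullback.snd g ρ ≫ b) hW _ hq
  rwa [div_pow, div_eq_one] at hqN

/-- **The two pull-backs of the `N`-th power of ONE local lift to the kernel pair agree** — the descent datum for `F ^ N`
along `c` (`pr₁ ≫ F ^ N = pr₂ ≫ F ^ N` on `V ×_T V`, underlying schemes): ★ `pow_comp_eq_pow_comp_of_localLifts` with
`V₁ = V₂ = V`, `W = V ×_T V`. [cite: Katz1981SerreTate, §1.1 Lemmas 1.1.1–1.1.3] [cite: GortzWedhorn2020, Def. 14.69] -/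
theorem pow_comp_eq_pow_comp_of_localLift (hJ : J * J = ⊥) {N : ℕ} (hN : ∀ a ∈ J, (N : A) * a = 0)
    {T : Over (Spec (CommRingCat.of A))} {T₀ : Scheme.{u}} (ρ : T₀ ⟶ T.left) (b : T₀ ⟶ Spec (.of (A ⧸ J)))
    (hρ : IsPullback ρ b T.hom (Spec.map (CommRingCat.ofHom (Ideal.Quotient.mk J))))
    (u₀ : T₀ ⟶ G.left) {V : Over (Spec (CommRingCat.of A))} (c : V ⟶ T) (F : V ⟶ G)
    (hF : pullback.fst c.left ρ ≫ F.left = pullback.snd c.left ρ ≫ u₀) :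
    pullback.fst c.left c.left ≫ (F ^ N).left = pullback.snd c.left c.left ≫ (F ^ N).left := by
  -- the kernel pair `W = V ×_T V` as a `Spec A`-scheme with its two projections
  have hw₂ : pullback.snd c.left c.left ≫ V.hom = pullback.fst c.left c.left ≫ V.hom := by
    rw [← Over.w c, ← Category.assoc, ← Category.assoc, pullback.condition]
  let W : Over (Spec (CommRingCat.of A)) := Over.mk (pullback.fst c.left c.left ≫ V.hom)
  let pr₁ : W ⟶ V := Over.homMk (pullback.fst c.left c.left) rfl
  let pr₂ : W ⟶ V := Over.homMk (pullback.snd c.left c.left) hw₂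
  have hpr : pr₁ ≫ c = pr₂ ≫ c := Over.OverMorphism.ext pullback.condition
  have hpow := congrArg Over.Hom.left
    (pow_comp_eq_pow_comp_of_localLifts hJ hN ρ b hρ u₀ c c F F hF hF pr₁ pr₂ hpr)
  rw [← MonObj.comp_pow, ← MonObj.comp_pow, Over.comp_left, Over.comp_left] at hpow
  exact hpow

/-- **DESCENT OF THE `N`-TH POWER OF A LOCAL LIFT** ([Katz1981SerreTate] §1.1 Lemmas 1.1.1–1.1.3 «`N` × any lift is well
defined»; [GortzWedhorn2020] Thm. 14.72 fpqc descent of morphisms): `A` local, `J² = 0`, `N · J = 0`; `G` a commutative group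
object of `Over (Spec A)`; `T` an `Spec A`-scheme with cartesian reduction square `(ρ, b)` over `Spec (A⧸J) ↪ Spec A`;
`u₀ : T₀ → G`; `c : V → T` flat, surjective and quasi-compact with ONE lift `F : V → G` of `u₀`
(`F ∣_{V ×_T T₀} = u₀ ∘ pr₂`).  Then there is a UNIQUE `δ : T → G` over `Spec A` with `c ≫ δ = F ^ N`.
[cite: Katz1981SerreTate, §1.1 Lemmas 1.1.1–1.1.3] [cite: GortzWedhorn2020, Thm. 14.72] [cite: StacksProject, Tag 023Q] -/
theorem existsUnique_desc_pow_of_localLift (hJ : J * J = ⊥) {N : ℕ} (hN : ∀ a ∈ J, (N : A) * a = 0)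
    {T : Over (Spec (CommRingCat.of A))} {T₀ : Scheme.{u}} (ρ : T₀ ⟶ T.left) (b : T₀ ⟶ Spec (.of (A ⧸ J)))
    (hρ : IsPullback ρ b T.hom (Spec.map (CommRingCat.ofHom (Ideal.Quotient.mk J))))
    (u₀ : T₀ ⟶ G.left) {V : Over (Spec (CommRingCat.of A))} (c : V ⟶ T)
    [Flat c.left] [Surjective c.left] [QuasiCompact c.left] (F : V ⟶ G)
    (hF : pullback.fst c.left ρ ≫ F.left = pullback.snd c.left ρ ≫ u₀) :
    ∃! δ : T ⟶ G, c ≫ δ = F ^ N :=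
  Literature.AlgebraicGeometry.Morphisms.SchemeOver.existsUnique_desc_of_pullback_comp_eq c (F ^ N)
    (pow_comp_eq_pow_comp_of_localLift hJ hN ρ b hρ u₀ c F hF)

/-- **INDEPENDENCE of the cover and of the lift** ([Katz1981SerreTate] §1.1 Lemma 1.1.3 (3) «well defined»): two fpqc
covers `cᵢ : Vᵢ → T` with lifts `Fᵢ` of the same `u₀` and descended morphisms `δᵢ` (`cᵢ ≫ δᵢ = Fᵢ ^ N`) give `δ₁ = δ₂`:
on `V₁ ×_T V₂` both pull back to the common value `(pr₁ ≫ F₁) ^ N = (pr₂ ≫ F₂) ^ N` of ★ `pow_comp_eq_pow_comp_of_localLifts`,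
and `V₁ ×_T V₂ → T` is again fpqc (★ `Morphisms.hom_ext_of_fpqc`). [cite: Katz1981SerreTate, §1.1 Lemmas 1.1.1–1.1.3]
[cite: GortzWedhorn2020, Thm. 14.72] -/
theorem desc_pow_eq_desc_pow_of_localLifts (hJ : J * J = ⊥) {N : ℕ} (hN : ∀ a ∈ J, (N : A) * a = 0)
    {T : Over (Spec (CommRingCat.of A))} {T₀ : Scheme.{u}} (ρ : T₀ ⟶ T.left) (b : T₀ ⟶ Spec (.of (A ⧸ J)))
    (hρ : IsPullback ρ b T.hom (Spec.map (CommRingCat.ofHom (Ideal.Quotient.mk J))))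
    (u₀ : T₀ ⟶ G.left) {V₁ V₂ : Over (Spec (CommRingCat.of A))} (c₁ : V₁ ⟶ T) (c₂ : V₂ ⟶ T)
    [Flat c₁.left] [Surjective c₁.left] [QuasiCompact c₁.left] [Flat c₂.left] [Surjective c₂.left] [QuasiCompact c₂.left]
    (F₁ : V₁ ⟶ G) (F₂ : V₂ ⟶ G) (hF₁ : pullback.fst c₁.left ρ ≫ F₁.left = pullback.snd c₁.left ρ ≫ u₀)
    (hF₂ : pullback.fst c₂.left ρ ≫ F₂.left = pullback.snd c₂.left ρ ≫ u₀)
    (δ₁ δ₂ : T ⟶ G) (hδ₁ : c₁ ≫ δ₁ = F₁ ^ N) (hδ₂ : c₂ ≫ δ₂ = F₂ ^ N) : δ₁ = δ₂ := by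
  -- the common refinement `V₁ ×_T V₂`, fpqc over `T` through `V₁`
  have hw₂ : pullback.snd c₁.left c₂.left ≫ V₂.hom = pullback.fst c₁.left c₂.left ≫ V₁.hom := by
    rw [← Over.w c₂, ← Over.w c₁, ← Category.assoc, ← Category.assoc, pullback.condition]
  let W : Over (Spec (CommRingCat.of A)) := Over.mk (pullback.fst c₁.left c₂.left ≫ V₁.hom)
  let p₁ : W ⟶ V₁ := Over.homMk (pullback.fst c₁.left c₂.left) rfl
  let p₂ : W ⟶ V₂ := Over.homMk (pullback.snd c₁.left c₂.left) hw₂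
  have hp : p₁ ≫ c₁ = p₂ ≫ c₂ := Over.OverMorphism.ext pullback.condition
  have hpow := pow_comp_eq_pow_comp_of_localLifts hJ hN ρ b hρ u₀ c₁ c₂ F₁ F₂ hF₁ hF₂ p₁ p₂ hp
  -- `δ₁` and `δ₂` agree after the fpqc cover `V₁ ×_T V₂ → T`
  have h : p₁ ≫ c₁ ≫ δ₁ = p₁ ≫ c₁ ≫ δ₂ := by
    conv_rhs => rw [← Category.assoc, hp, Category.assoc, hδ₂, MonObj.comp_pow, ← hpow, ← MonObj.comp_pow, ← hδ₁]
  apply Over.OverMorphism.ext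
  refine Literature.AlgebraicGeometry.Morphisms.hom_ext_of_fpqc (pullback.fst c₁.left c₂.left ≫ c₁.left) ?_
  have h' := congrArg Over.Hom.left h
  simp only [Over.comp_left, Over.homMk_left, p₁] at h'
  rw [Category.assoc, Category.assoc]
  exact h'

omit [IsLocalRing A] [IsCommMonObj G] in
/-- **REDUCTION of the descended morphism** ([Katz1981SerreTate] §1.1 Lemma 1.1.3 (3)): if `u₀` is a morphism over `Spec A`
(`u₀ ≫ G.hom = ρ ≫ T.hom`), the descended `δ` restricts on the thickening to `u₀ ^ N`: `ρ ≫ δ = u₀ ^ N` as morphisms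
`T₀ → G` over `Spec A` — checked after the fpqc cover `V ×_T T₀ → T₀`, where both sides equal `(pr₁ ≫ F) ^ N`.
[cite: Katz1981SerreTate, §1.1 Lemmas 1.1.1–1.1.3] [cite: GortzWedhorn2020, Thm. 14.72] -/
theorem restrict_desc_pow_eq {N : ℕ} {T : Over (Spec (CommRingCat.of A))} {T₀ : Scheme.{u}} (ρ : T₀ ⟶ T.left)
    (u₀ : T₀ ⟶ G.left) (hu₀ : u₀ ≫ G.hom = ρ ≫ T.hom) {V : Over (Spec (CommRingCat.of A))} (c : V ⟶ T)
    [Flat c.left] [Surjective c.left] [QuasiCompact c.left] (F : V ⟶ G)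
    (hF : pullback.fst c.left ρ ≫ F.left = pullback.snd c.left ρ ≫ u₀) (δ : T ⟶ G) (hδ : c ≫ δ = F ^ N) :
    (Over.homMk ρ rfl : Over.mk (ρ ≫ T.hom) ⟶ T) ≫ δ = (Over.homMk u₀ hu₀ : Over.mk (ρ ≫ T.hom) ⟶ G) ^ N := by
  -- `V ×_T T₀` over `Spec A`, its projections to `V` and to `T₀`
  have hw : pullback.snd c.left ρ ≫ ρ ≫ T.hom = pullback.fst c.left ρ ≫ V.hom := by
    rw [← Over.w c, ← Category.assoc, ← Category.assoc, pullback.condition]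
  let V₀ : Over (Spec (CommRingCat.of A)) := Over.mk (pullback.fst c.left ρ ≫ V.hom)
  let q₁ : V₀ ⟶ V := Over.homMk (pullback.fst c.left ρ) rfl
  let c₀ : V₀ ⟶ Over.mk (ρ ≫ T.hom) := Over.homMk (pullback.snd c.left ρ) hw
  -- on `V ×_T T₀`: `F` restricts to `u₀`, so `F ^ N` restricts to `u₀ ^ N`; and `c ≫ δ = F ^ N`
  have hq : q₁ ≫ F = c₀ ≫ Over.homMk u₀ hu₀ := Over.OverMorphism.ext hF
  have h : c₀ ≫ (Over.homMk ρ rfl : Over.mk (ρ ≫ T.hom) ⟶ T) ≫ δ =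
      c₀ ≫ (Over.homMk u₀ hu₀ : Over.mk (ρ ≫ T.hom) ⟶ G) ^ N := by
    have hc : c₀ ≫ (Over.homMk ρ rfl : Over.mk (ρ ≫ T.hom) ⟶ T) = q₁ ≫ c :=
      Over.OverMorphism.ext pullback.condition.symm
    rw [← Category.assoc, hc, Category.assoc, hδ, MonObj.comp_pow, hq, ← MonObj.comp_pow]
  -- cancel the fpqc cover `V ×_T T₀ → T₀`
  apply Over.OverMorphism.ext
  refine Literature.AlgebraicGeometry.Morphisms.hom_ext_of_fpqc (pullback.snd c.left ρ) ?_
  have h' := congrArg Over.Hom.left h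
  simp only [Over.comp_left, Over.homMk_left, c₀] at h'
  exact h'

end Literature.AlgebraicGeometry.GroupSchemes.PowerLiftDescent

end
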